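import Summits.AtomisticToContinuum.Crystallization.Theorems.FrustratedLawDichotomySignedLedgerErgodic
import Summits.AtomisticToContinuum.Crystallization.Theorems.FrustratedLawDichotomyTransportPriceLocal

/-!
# FrustratedLawDichotomy · crux `AperiodicFrustratedLawGap` (stmt-AtomisticToContinuum-27623) — the signed ledger from a REAL SIGNED KERNEL
# (decomp-a2c hand-2 g45, STRUCTURAL share #50: DEF-FREE sockets over the tree's `…SignedLedger` / `…SignedLedgerErgodic`)

The E′ line's first-variation transport is a REAL, SIGNED, FINITE-RANGE, BOUNDED kernel on rooted configurations (lens-5 g109 §3: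
`s(j → k) = ¼ φ′(|B|) B̂ · (u_k + u_j)` along the window bonds).  The tree's ledger (`…SignedLedger.LawLedger`) wants instead two `ℝ≥0∞`
kernels `F`, `G` with `Measurable (Function.uncurry ·)` and finite mean out-flows, and states its floors through `net F G μ` (four `lintegral`s).
This file is the socket in KERNEL CURRENCY, with NO new definitions: for a jointly measurable real kernel `s` which, on rooted `δ`-hard-core
configurations, is bounded (`|s μ y| ≤ M`) and of finite range (`s μ y = 0` for `‖y‖ > r`), and the explicit parts
`F = ENNReal.ofReal ∘ s`, `G = ENNReal.ofReal ∘ (−s)`: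

* §1 `measurable_posPart` / `measurable_negPart` (joint measurability of the parts), `lintegral_part_le` (uniform out-flow bound on hard-core
  configurations, from `…TransportPriceLocal.exists_outflow_bound_of_finiteRange`), `outflow_parts_ne_top` (finite mean out-flows under any
  probability law a.s. carried by rooted `δ`-hard-core configurations);
* §2 `integrable_kernel_out` / `integrable_kernel_in` (the out- and in-flow integrands `y ↦ s μ y`, `y ↦ s (θ_y μ) (−y)` are `μ`-integrable —
  finite sums over the atoms of the `r`-ball) and ★ `net_parts_eq` : `net F G μ = ∫ y, s (θ_y μ) (−y) ∂μ − ∫ y, s μ y ∂μ` on every rooted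
  `δ`-hard-core `μ` — the ledger's redistribution term IS «signed in-flow minus signed out-flow»;
* §3 the producers in kernel currency: ★ `nonempty_lawLedger_of_signedKernelFloor` (kernel + integrable envelope `ℓ` with
  `c + ℓ μ ≤ rootEnergy μ + (∫ s_in − ∫ s_out)` a.s. and `E_P[ℓ] > 0` ⟹ `Nonempty (LawLedger P c)`) and `lt_integral_rootEnergy_of_signedKernelFloor`.

With `…SignedLedgerErgodic` the E′ assembly therefore needs, per regime, only: the kernel `s` (jointly measurable, bounded, finite range), the
envelope `ℓ`, the pointwise floor in real numbers, and `E_P[ℓ] > 0`.  Tags: [folklore: bookkeeping / measure theory on counting measures].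
-/

noncomputable section

namespace Summit.AtomisticToContinuum.Crystallization.Theorems.FrustratedLawDichotomySignedLedgerKernel

open MeasureTheory Metric Set Filter
open scoped ENNReal Topology BigOperators
open Literature.MathematicalPhysics.StatisticalMechanics Literature.Probability.Process
open Summit.AtomisticToContinuum.Crystallization.Theorems.ChargedEnergyGapNegative (E3 eStar)
open Summit.AtomisticToContinuum.Crystallization.Theorems.FrustratedLawDichotomySignedLedger
open Summit.AtomisticToContinuum.Crystallization.Theorems.FrustratedLawDichotomySignedLedgerErgodic
  (nonempty_lawLedger_of_integrableFloor)
open Summit.AtomisticToContinuum.Crystallization.Theorems.FrustratedLawDichotomyTransportPrice (lintegral_outflow_ne_top_of_bound)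
open Summit.AtomisticToContinuum.Crystallization.Theorems.FrustratedLawDichotomyTransportPriceLocal (exists_outflow_bound_of_finiteRange)
open Summit.AtomisticToContinuum.Crystallization.Theorems.FrustratedLawDichotomyFiniteClusterGap (ae_mem_of_sep measurable_reroot_section)
open Literature.Probability.Process.LocalConfig (finite_inter_of_separated)

variable {δ : ℝ} {P : Measure (Measure E3)} {s : Measure E3 → E3 → ℝ} {M r : ℝ}

/-! ## §1. The two parts of a real kernel: measurability and finite out-flows -/

/-- The positive part `ENNReal.ofReal ∘ s` of a jointly measurable real kernel is jointly measurable. [folklore] -/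
theorem measurable_posPart (hs : Measurable (Function.uncurry s)) :
    Measurable (Function.uncurry fun (μ : Measure E3) (y : E3) => ENNReal.ofReal (s μ y)) :=
  ENNReal.measurable_ofReal.comp hs

/-- The negative part `ENNReal.ofReal ∘ (−s)` of a jointly measurable real kernel is jointly measurable. [folklore] -/
theorem measurable_negPart (hs : Measurable (Function.uncurry s)) :
    Measurable (Function.uncurry fun (μ : Measure E3) (y : E3) => ENNReal.ofReal (-s μ y)) :=
  ENNReal.measurable_ofReal.comp hs.neg

/-- **Uniform out-flow bound for the parts.**  For `δ > 0` there is a finite `C` bounding `∫⁻ y, ENNReal.ofReal (±s μ y) ∂μ` on every rooted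
`δ`-hard-core `μ`, as soon as `s` is bounded by `M` and vanishes outside the `r`-ball on such configurations. [folklore] -/
theorem lintegral_parts_le (hδ : 0 < δ) (hM : ∀ μ : Measure E3, IsRootedHardCore δ μ → ∀ y, |s μ y| ≤ M)
    (hr : ∀ μ : Measure E3, IsRootedHardCore δ μ → ∀ y : E3, r < ‖y‖ → s μ y = 0) :
    ∃ C : ℝ≥0∞, C ≠ ∞ ∧ ∀ μ : Measure E3, IsRootedHardCore δ μ →
      ∫⁻ y, ENNReal.ofReal (s μ y) ∂μ ≤ C ∧ ∫⁻ y, ENNReal.ofReal (-s μ y) ∂μ ≤ C := by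
  obtain ⟨C, hC, hCb⟩ := exists_outflow_bound_of_finiteRange hδ r (M := ENNReal.ofReal M) ENNReal.ofReal_ne_top
  refine ⟨C, hC, fun μ hμ => ⟨hCb μ hμ _ (fun y => ?_) (fun y hy => ?_), hCb μ hμ _ (fun y => ?_) (fun y hy => ?_)⟩⟩
  · exact ENNReal.ofReal_le_ofReal ((le_abs_self _).trans (hM μ hμ y))
  · rw [hr μ hμ y hy, ENNReal.ofReal_zero]
  · exact ENNReal.ofReal_le_ofReal ((neg_le_abs _).trans (hM μ hμ y))
  · rw [hr μ hμ y hy, neg_zero, ENNReal.ofReal_zero]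

/-- **Finite mean out-flows of both parts** under a probability law almost surely carried by rooted `δ`-hard-core configurations. [folklore] -/
theorem outflow_parts_ne_top (hδ : 0 < δ) [IsProbabilityMeasure P] (hcore : ∀ᵐ μ ∂P, IsRootedHardCore δ μ)
    (hM : ∀ μ : Measure E3, IsRootedHardCore δ μ → ∀ y, |s μ y| ≤ M)
    (hr : ∀ μ : Measure E3, IsRootedHardCore δ μ → ∀ y : E3, r < ‖y‖ → s μ y = 0) :
    (∫⁻ μ, ∫⁻ y, ENNReal.ofReal (s μ y) ∂μ ∂P ≠ ∞) ∧ (∫⁻ μ, ∫⁻ y, ENNReal.ofReal (-s μ y) ∂μ ∂P ≠ ∞) := by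
  obtain ⟨C, hC, hCb⟩ := lintegral_parts_le hδ hM hr
  refine ⟨lintegral_outflow_ne_top_of_bound (F := fun μ y => ENNReal.ofReal (s μ y)) hC ?_,
    lintegral_outflow_ne_top_of_bound (F := fun μ y => ENNReal.ofReal (-s μ y)) hC ?_⟩
  · filter_upwards [hcore] with μ hμ using (hCb μ hμ).1
  · filter_upwards [hcore] with μ hμ using (hCb μ hμ).2

/-! ## §2. On one rooted hard-core configuration: integrable flow integrands and `net = ∫ in − ∫ out` -/

section OneConfiguration

variable {μ : Measure E3}

/-- On a rooted `δ`-hard-core configuration (`δ > 0`) the closed `r`-ball has finite mass. [folklore] -/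
theorem measure_closedBall_lt_top (hδ : 0 < δ) (hμ : IsRootedHardCore δ μ) (r : ℝ) : μ (closedBall (0 : E3) r) < ∞ := by
  obtain ⟨S, -, hsep, rfl⟩ := hμ
  rw [Measure.restrict_apply measurableSet_closedBall,
    Measure.count_apply_finite _ (finite_inter_of_separated hδ hsep (isCompact_closedBall (0 : E3) r))]
  exact ENNReal.natCast_lt_top _

/-- A bounded measurable real function vanishing outside the `r`-ball is integrable against a rooted `δ`-hard-core configuration
(a finite sum over the atoms of the ball). [folklore] -/
theorem integrable_of_bounded_finiteRange (hδ : 0 < δ) (hμ : IsRootedHardCore δ μ) {f : E3 → ℝ} (hf : Measurable f)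
    (hfM : ∀ y, |f y| ≤ M) (hfr : ∀ y : E3, r < ‖y‖ → f y = 0) : Integrable f μ := by
  have hfin : μ (closedBall (0 : E3) r) < ∞ := measure_closedBall_lt_top hδ hμ r
  haveI : IsFiniteMeasure (μ.restrict (closedBall (0 : E3) r)) := ⟨by rwa [Measure.restrict_apply_univ]⟩
  have hon : IntegrableOn f (closedBall (0 : E3) r) μ :=
    Integrable.of_bound hf.aestronglyMeasurable M (ae_of_all _ fun y => by rw [Real.norm_eq_abs]; exact hfM y)
  refine hon.integrable_of_forall_notMem_eq_zero fun y hy => hfr y ?_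
  rwa [mem_closedBall, dist_zero_right, not_le] at hy

/-- **The out-flow integrand is integrable**: `y ↦ s μ y` against the rooted `δ`-hard-core configuration `μ`. [folklore] -/
theorem integrable_kernel_out (hδ : 0 < δ) (hμ : IsRootedHardCore δ μ) (hs : Measurable (Function.uncurry s))
    (hM : ∀ μ : Measure E3, IsRootedHardCore δ μ → ∀ y, |s μ y| ≤ M)
    (hr : ∀ μ : Measure E3, IsRootedHardCore δ μ → ∀ y : E3, r < ‖y‖ → s μ y = 0) :
    Integrable (fun y => s μ y) μ :=
  integrable_of_bounded_finiteRange hδ hμ (hs.comp measurable_prodMk_left) (hM μ hμ) (hr μ hμ)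

/-- **The in-flow integrand is measurable**: `y ↦ s (θ_y μ) (−y)` (through the tree's measurable re-rooting sections of the two parts). [folklore] -/
theorem measurable_kernel_in (hδ : 0 < δ) (hμ : IsRootedHardCore δ μ) (hs : Measurable (Function.uncurry s)) :
    Measurable fun y : E3 => s (μ.map fun z => z - y) (-y) := by
  have h1 := (measurable_reroot_section hδ hμ (measurable_posPart hs)).ennreal_toReal
  have h2 := (measurable_reroot_section hδ hμ (measurable_negPart hs)).ennreal_toReal
  have heq : (fun y : E3 => s (μ.map fun z => z - y) (-y)) = fun y : E3 =>
      (ENNReal.ofReal (s (μ.map fun z => z - y) (-y))).toReal - (ENNReal.ofReal (-s (μ.map fun z => z - y) (-y))).toReal := by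
    funext y
    rw [ENNReal.toReal_ofReal', ENNReal.toReal_ofReal']
    exact (max_zero_sub_max_neg_zero_eq_self _).symm
  rw [heq]
  exact h1.sub h2

/-- **The in-flow integrand is integrable**: `y ↦ s (θ_y μ) (−y)` against `μ` (for atoms `y` the re-rooted configuration is again rooted
`δ`-hard-core, so the bound and the range apply; non-atoms are `μ`-null). [folklore] -/
theorem integrable_kernel_in (hδ : 0 < δ) (hμ : IsRootedHardCore δ μ) (hs : Measurable (Function.uncurry s))
    (hM : ∀ μ : Measure E3, IsRootedHardCore δ μ → ∀ y, |s μ y| ≤ M)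
    (hr : ∀ μ : Measure E3, IsRootedHardCore δ μ → ∀ y : E3, r < ‖y‖ → s μ y = 0) :
    Integrable (fun y => s (μ.map fun z => z - y) (-y)) μ := by
  obtain ⟨S, h0S, hsep, hμS⟩ := id hμ
  -- replace the integrand by its restriction to atoms (a.e. equal), which is bounded and of finite range everywhere
  have hθ : ∀ y ∈ S, IsRootedHardCore δ (μ.map fun z : E3 => z - y) := fun y hy =>
    hμ.map_sub (by rw [hμS]; exact (count_restrict_singleton_ne_zero_iff S y).mpr hy)
  have hSm : MeasurableSet S := by
    have hc : S.Countable := by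
      have hfin : ∀ n : ℕ, (closedBall (0 : E3) n ∩ S).Finite := fun n =>
        finite_inter_of_separated hδ hsep (isCompact_closedBall (0 : E3) n)
      have : S = ⋃ n : ℕ, closedBall (0 : E3) n ∩ S := by
        ext x
        simp only [mem_iUnion, mem_inter_iff, mem_closedBall, dist_zero_right]
        exact ⟨fun hx => ⟨⌈‖x‖⌉₊, Nat.le_ceil _, hx⟩, fun ⟨n, _, hx⟩ => hx⟩
      rw [this]
      exact countable_iUnion fun n => (hfin n).countable
    exact hc.measurableSet
  set g : E3 → ℝ := S.indicator fun y => s (μ.map fun z => z - y) (-y) with hg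
  have hgm : Measurable g := (measurable_kernel_in hδ hμ hs).indicator hSm
  have hgM : ∀ y, |g y| ≤ M := by
    intro y
    have hM0 : 0 ≤ M := (abs_nonneg _).trans (hM μ hμ 0)
    by_cases hy : y ∈ S
    · rw [hg, Set.indicator_of_mem hy]
      exact hM _ (hθ y hy) _
    · rw [hg, Set.indicator_of_notMem hy, abs_zero]
      exact hM0
  have hgr : ∀ y : E3, r < ‖y‖ → g y = 0 := by
    intro y hy
    by_cases hyS : y ∈ S
    · rw [hg, Set.indicator_of_mem hyS]
      exact hr _ (hθ y hyS) _ (by rwa [norm_neg])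
    · rw [hg, Set.indicator_of_notMem hyS]
  have hgi : Integrable g μ := integrable_of_bounded_finiteRange hδ hμ hgm hgM hgr
  refine hgi.congr ?_
  have hS : ∀ᵐ y ∂μ, y ∈ S := by rw [hμS]; exact ae_mem_of_sep hδ hsep
  filter_upwards [hS] with y hy
  rw [hg, Set.indicator_of_mem hy]

/-- **THE NET FLOW IN REAL NUMBERS.**  On a rooted `δ`-hard-core configuration `μ`, for the parts `F = ENNReal.ofReal ∘ s`, `G = ENNReal.ofReal ∘ (−s)`
of a jointly measurable, bounded, finite-range real kernel:  `net F G μ = ∫ y, s (θ_y μ) (−y) ∂μ − ∫ y, s μ y ∂μ`  (signed in-flow minus signed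
out-flow, both finite sums over atoms). [folklore] -/
theorem net_parts_eq (hδ : 0 < δ) (hμ : IsRootedHardCore δ μ) (hs : Measurable (Function.uncurry s))
    (hM : ∀ μ : Measure E3, IsRootedHardCore δ μ → ∀ y, |s μ y| ≤ M)
    (hr : ∀ μ : Measure E3, IsRootedHardCore δ μ → ∀ y : E3, r < ‖y‖ → s μ y = 0) :
    net (fun μ y => ENNReal.ofReal (s μ y)) (fun μ y => ENNReal.ofReal (-s μ y)) μ =
      (∫ y, s (μ.map fun z => z - y) (-y) ∂μ) - ∫ y, s μ y ∂μ := by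
  have hin := integrable_kernel_in hδ hμ hs hM hr
  have hout := integrable_kernel_out hδ hμ hs hM hr
  rw [integral_eq_lintegral_pos_part_sub_lintegral_neg_part hin, integral_eq_lintegral_pos_part_sub_lintegral_neg_part hout]
  rfl

end OneConfiguration

/-! ## §3. The ledger producers in kernel currency -/

/-- **SIGNED-KERNEL PRODUCER.**  A probability law `P` a.s. carried by rooted `δ`-hard-core configurations, a jointly measurable real kernel `s`
(bounded by `M`, range `r` on such configurations), an integrable envelope `ℓ` with the REAL floor
`c + ℓ μ ≤ rootEnergy V_LJ μ + (∫ y, s (θ_y μ)(−y) ∂μ − ∫ y, s μ y ∂μ)` a.s. and `0 < E_P[ℓ]` give a signed ledger at level `c`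
(parts `ofReal ∘ s`, `ofReal ∘ (−s)`). [folklore: bookkeeping] -/
theorem nonempty_lawLedger_of_signedKernelFloor (hδ : 0 < δ) [IsProbabilityMeasure P] (hcore : ∀ᵐ μ ∂P, IsRootedHardCore δ μ)
    (hs : Measurable (Function.uncurry s)) (hM : ∀ μ : Measure E3, IsRootedHardCore δ μ → ∀ y, |s μ y| ≤ M)
    (hr : ∀ μ : Measure E3, IsRootedHardCore δ μ → ∀ y : E3, r < ‖y‖ → s μ y = 0) {c : ℝ} {ℓ : Measure E3 → ℝ}
    (hℓ : Integrable ℓ P)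
    (hfloor : ∀ᵐ μ ∂P, c + ℓ μ ≤ rootEnergy lennardJones μ + ((∫ y, s (μ.map fun z => z - y) (-y) ∂μ) - ∫ y, s μ y ∂μ))
    (hpos : 0 < ∫ μ, ℓ μ ∂P) : Nonempty (LawLedger P c) := by
  obtain ⟨houtF, houtG⟩ := outflow_parts_ne_top hδ hcore hM hr
  refine nonempty_lawLedger_of_integrableFloor (measurable_posPart hs) (measurable_negPart hs) houtF houtG hℓ ?_ hpos
  filter_upwards [hcore, hfloor] with μ hμ hfl
  rwa [net_parts_eq hδ hμ hs hM hr]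

/-- **The signed-kernel floor prices the mean**: under point-stationarity as well, `c < E_P[rootEnergy V_LJ]`. [folklore: bookkeeping] -/
theorem lt_integral_rootEnergy_of_signedKernelFloor (hδ : 0 < δ) [IsProbabilityMeasure P] (hcore : ∀ᵐ μ ∂P, IsRootedHardCore δ μ)
    (hstat : IsPointStationaryLaw P)
    (hs : Measurable (Function.uncurry s)) (hM : ∀ μ : Measure E3, IsRootedHardCore δ μ → ∀ y, |s μ y| ≤ M)
    (hr : ∀ μ : Measure E3, IsRootedHardCore δ μ → ∀ y : E3, r < ‖y‖ → s μ y = 0) {c : ℝ} {ℓ : Measure E3 → ℝ}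
    (hℓ : Integrable ℓ P)
    (hfloor : ∀ᵐ μ ∂P, c + ℓ μ ≤ rootEnergy lennardJones μ + ((∫ y, s (μ.map fun z => z - y) (-y) ∂μ) - ∫ y, s μ y ∂μ))
    (hpos : 0 < ∫ μ, ℓ μ ∂P) : c < ∫ μ, rootEnergy lennardJones μ ∂P := by
  obtain ⟨L⟩ := nonempty_lawLedger_of_signedKernelFloor hδ hcore hs hM hr hℓ hfloor hpos
  exact L.lt_integral_rootEnergy hδ hcore hstat

end Summit.AtomisticToContinuum.Crystallization.Theorems.FrustratedLawDichotomySignedLedgerKernel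

end
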